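import Mathlib
import Literature.AlgebraicGeometry.Tropical.TropicalLink
import Summits.ResolutionOfSingularities.ResolutionOfSingularities.Theorems.TropicalLinksInductiveStepWeightZero

/-!
# TropicalLinks / SchonResolves — the vertex chart ring as the image of the adapted polynomial chart

Route `ResolutionOfSingularities/TropicalLinks`, crux `SchonResolves` (stmt-ResolutionOfSingularities-17234),
line `zariski-toric-closure`, stub `stub_chartImage` (glue).

Setting: fields `k ⊆ K`, a `k`-algebra map `ev' : k[ℤ^n] →ₐ[k] K` (`J := ker ev'`, so that
`k[ℤ^n] ⧸ J ↪ K` is a very affine chart of `K`), a lattice automorphism `φ : ℤ^n ≃+ ℤ^n` adapted to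
a vertex `a` of a family of lattice points `A : Fin (N+1) → ℤ^n`: all differences `A b − A a` lie
in the dual cone `σ^∨ := φ⁻¹(ℕ^n)` (h1) and the dual basis `φ⁻¹(e_i)` occurs among them (h2).
Two chart rings are attached to the vertex:

* the ADAPTED POLYNOMIAL CHART `k[ℕ^n] ⧸ JB`, `JB := linkIdeal castN (J.map k[φ])`
  (`castN : ℕ^n ↪ ℤ^n`), the coordinate ring of the closure of `φ · V(J)` in `𝔸^n` — the object
  the algebraic chart-regularity theorem of the line speaks about;
* the IMAGE CHART RING `D := k[ev' (x^{A b − A a}) : b] ⊆ K`, the affine coordinate ring of the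
  standard chart `z_a ≠ 0` of the projective closure of the `K`-point `[ev' (x^{A b})]_b` — the
  object the scheme-theoretic side of the line speaks about.

We prove (`stub_chartImage`): (b) `D` contains `ev' (x^v)` for every `v ∈ σ^∨` — by (h2),
`v = Σ_i (φ v)_i • (A b_i − A a)` with `φ (A b_i − A a) = e_i`, so `x^v` is a monomial in the
generators; (a) if `k[ℕ^n] ⧸ JB` is regular at every prime then so is `D` — the `k`-algebra map
`θ : k[ℕ^n] → K`, `x^u ↦ ev' (x^{φ⁻¹ u})`, has image exactly `D` (`⊆` by (b), `⊇` by (h1)) and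
kernel exactly `JB` (unwinding `linkIdeal` and the image of an ideal under the monomial change of
coordinates `k[φ]`), so `k[ℕ^n] ⧸ JB ≃ₐ[k] D` by the first isomorphism theorem, and regularity at
all primes is transported along this isomorphism (`tropicalLinks_forall_prime_regular_of_ringEquiv`).
Elementary algebra; the toric background (coordinate rings `k[σ^∨ ∩ M]` of affine toric charts) is
Fulton, *Introduction to toric varieties* (1993), §1.3, no statement of which is relied upon.
-/

-- single-problem summit: the doubled namespace component `ResolutionOfSingularities` is forced
set_option linter.dupNamespace false

namespace Summit.ResolutionOfSingularities.ResolutionOfSingularities.Theorems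

open AddMonoidAlgebra Literature.AlgebraicGeometry.Tropical

/-- **Monomials multiply by adding exponents**: `x^{Σ m_i • w_i} = ∏ (x^{w_i})^{m_i}` in an additive
monoid algebra. [folklore] -/
theorem schonResolves_single_sum_nsmul {k : Type*} [CommSemiring k] {M : Type*} [AddCommMonoid M]
    {ι : Type*} (s : Finset ι) (w : ι → M) (m : ι → ℕ) :
    (single (∑ i ∈ s, m i • w i) (1 : k) : AddMonoidAlgebra k M) =
      ∏ i ∈ s, single (w i) (1 : k) ^ m i := by
  simp_rw [AddMonoidAlgebra.single_pow, one_pow, AddMonoidAlgebra.prod_single,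
    Finset.prod_const_one]

/-- **The dual-cone monomials lie in the vertex chart ring.** If the dual basis occurs among the
`φ (A b − A a)` (h2), then for every exponent `v` with `φ v ≥ 0` the element `ev' (x^v)` is a
monomial `∏ ev' (x^{A b_i − A a})^{(φ v)_i}` in the generators of
`D = k[ev' (x^{A b − A a}) : b]`, hence lies in `D`. [folklore] -/
theorem schonResolves_ev_single_mem_adjoin {k : Type*} [Field k] {K : Type*} [Field K]
    [Algebra k K] {n N : ℕ} (ev' : AddMonoidAlgebra k (Fin n → ℤ) →ₐ[k] K)
    (φ : (Fin n → ℤ) ≃+ (Fin n → ℤ)) (A : Fin (N + 1) → (Fin n → ℤ)) (a : Fin (N + 1))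
    (h2 : ∀ i : Fin n, ∃ b : Fin (N + 1), φ (A b - A a) = Pi.single i 1)
    (v : Fin n → ℤ) (hv : ∀ i, 0 ≤ φ v i) :
    ev' (AddMonoidAlgebra.single v (1 : k)) ∈
      Algebra.adjoin k (Set.range fun b : Fin (N + 1) =>
        ev' (AddMonoidAlgebra.single (A b - A a) (1 : k))) := by
  choose b hb using h2
  -- `v` is the combination of the dual-cone generators `A (b i) - A a` with coefficients `φ v`
  have hv' : v = ∑ i, (φ v i).toNat • (A (b i) - A a) := by
    apply φ.injective
    rw [map_sum]
    simp_rw [map_nsmul, hb]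
    funext j
    rw [Finset.sum_apply, Finset.sum_eq_single j]
    · rw [Pi.smul_apply, Pi.single_eq_same, nsmul_one, Int.toNat_of_nonneg (hv j)]
    · intro i _ hij
      rw [Pi.smul_apply, Pi.single_eq_of_ne' hij, smul_zero]
    · intro hj
      exact absurd (Finset.mem_univ j) hj
  have hsingle : (AddMonoidAlgebra.single v (1 : k) : AddMonoidAlgebra k (Fin n → ℤ)) =
      ∏ i, AddMonoidAlgebra.single (A (b i) - A a) (1 : k) ^ (φ v i).toNat := by
    rw [← schonResolves_single_sum_nsmul, ← hv']
  rw [hsingle, map_prod]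
  refine prod_mem fun i _ => ?_
  rw [map_pow]
  exact pow_mem (Algebra.subset_adjoin (Set.mem_range_self (b i))) _

/-- **The adapted polynomial chart maps isomorphically onto the vertex chart ring.** With
`J := ker ev'`, `castN : ℕ^n ↪ ℤ^n` and `D := k[ev' (x^{A b − A a}) : b] ⊆ K`: under (h1) (the
differences lie in `φ⁻¹(ℕ^n)`) and (h2) (the dual basis occurs among them), the `k`-algebra map
`θ : k[ℕ^n] → K`, `x^u ↦ ev' (x^{φ⁻¹ u})`, has image `D` and kernel `linkIdeal castN (J.map k[φ])`,
whence `k[ℕ^n] ⧸ linkIdeal castN (J.map k[φ]) ≃ₐ[k] D` (first isomorphism theorem). [folklore] -/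
theorem schonResolves_nonempty_quotient_linkIdeal_algEquiv_adjoin {k : Type} [Field k] {K : Type}
    [Field K] [Algebra k K] {n N : ℕ} (ev' : AddMonoidAlgebra k (Fin n → ℤ) →ₐ[k] K)
    (φ : (Fin n → ℤ) ≃+ (Fin n → ℤ)) (A : Fin (N + 1) → (Fin n → ℤ)) (a : Fin (N + 1))
    (h1 : ∀ (b : Fin (N + 1)) (i : Fin n), 0 ≤ φ (A b - A a) i)
    (h2 : ∀ i : Fin n, ∃ b : Fin (N + 1), φ (A b - A a) = Pi.single i 1) :
    Nonempty ((AddMonoidAlgebra k (Fin n → ℕ) ⧸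
        linkIdeal (AddMonoidHom.compLeft (Nat.castAddMonoidHom ℤ) (Fin n))
          ((RingHom.ker ev'.toRingHom).map (AddMonoidAlgebra.domCongr k k φ))) ≃ₐ[k]
      ↥(Algebra.adjoin k (Set.range fun b : Fin (N + 1) =>
        ev' (AddMonoidAlgebra.single (A b - A a) (1 : k))))) := by
  -- the dual-cone monomials lie in `D`
  have hb := schonResolves_ev_single_mem_adjoin ev' φ A a h2
  -- `D` is made opaque (only `hD` knows its definition)
  generalize hD : Algebra.adjoin k (Set.range fun b : Fin (N + 1) =>
    ev' (AddMonoidAlgebra.single (A b - A a) (1 : k))) = D at hb ⊢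
  -- `θ : x^u ↦ ev' (x^{φ⁻¹ u})`, as the composite `k[ℕ^n] → k[ℤ^n] ≃ k[ℤ^n] → K`
  obtain ⟨θ, hθ⟩ : ∃ θ : AddMonoidAlgebra k (Fin n → ℕ) →ₐ[k] K, ∀ g, θ g =
      ev' (AddMonoidAlgebra.domCongr k k φ.symm
        (mapDomain (AddMonoidHom.compLeft (Nat.castAddMonoidHom ℤ) (Fin n)) g)) :=
    ⟨ev'.comp ((AddMonoidAlgebra.domCongr k k φ.symm).toAlgHom.comp
      (AddMonoidAlgebra.mapDomainAlgHom k k (AddMonoidHom.compLeft (Nat.castAddMonoidHom ℤ) (Fin n)))),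
      fun g => rfl⟩
  -- its values on monomials
  have hθs : ∀ u : Fin n → ℕ, θ (AddMonoidAlgebra.single u 1) =
      ev' (AddMonoidAlgebra.single
        (φ.symm (AddMonoidHom.compLeft (Nat.castAddMonoidHom ℤ) (Fin n) u)) 1) := by
    intro u
    rw [hθ, mapDomain_single, AddMonoidAlgebra.domCongr_single]
  -- `θ` lands in `D`
  have hθD : ∀ g, θ g ∈ D := by
    intro g
    induction g using AddMonoidAlgebra.induction_linear with
    | zero =>
      rw [map_zero]
      exact zero_mem D
    | add x y hx hy =>
      rw [map_add]
      exact add_mem hx hy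
    | single u r =>
      have hs : (AddMonoidAlgebra.single u r : AddMonoidAlgebra k (Fin n → ℕ)) =
          r • AddMonoidAlgebra.single u (1 : k) := by
        rw [smul_single', mul_one]
      rw [hs, map_smul]
      refine Subalgebra.smul_mem D ?_ r
      rw [hθs]
      refine hb _ fun i => ?_
      rw [AddEquiv.apply_symm_apply]
      exact Int.natCast_nonneg (u i)
  -- every generator of `D` is a value of `θ` (h1)
  have hgen : ∀ b : Fin (N + 1),
      θ (AddMonoidAlgebra.single (fun i => (φ (A b - A a) i).toNat) 1) =
        ev' (AddMonoidAlgebra.single (A b - A a) 1) := by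
    intro b
    have hu : AddMonoidHom.compLeft (Nat.castAddMonoidHom ℤ) (Fin n)
        (fun i => (φ (A b - A a) i).toNat) = φ (A b - A a) :=
      funext fun i => Int.toNat_of_nonneg (h1 b i)
    rw [hθs, hu, AddEquiv.symm_apply_apply]
  have hle : D ≤ θ.range := by
    rw [← hD]
    refine Algebra.adjoin_le ?_
    rintro _ ⟨b, rfl⟩
    exact SetLike.mem_coe.mpr (θ.mem_range.mpr ⟨_, hgen b⟩)
  -- `θ` co-restricted to `D` is surjective, with kernel the link ideal
  have hsurj : Function.Surjective (θ.codRestrict D hθD) := by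
    rintro ⟨y, hy⟩
    obtain ⟨g, hg⟩ := θ.mem_range.mp (hle hy)
    exact ⟨g, Subtype.ext hg⟩
  have hker : RingHom.ker (θ.codRestrict D hθD) =
      linkIdeal (AddMonoidHom.compLeft (Nat.castAddMonoidHom ℤ) (Fin n))
        ((RingHom.ker ev'.toRingHom).map (AddMonoidAlgebra.domCongr k k φ)) := by
    ext g
    rw [RingHom.mem_ker, mem_linkIdeal_iff, mem_map_domCongr_iff, RingHom.mem_ker]
    constructor
    · intro h
      have h' := congrArg Subtype.val h
      rw [AlgHom.coe_codRestrict, hθ] at h'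
      exact h'
    · intro h
      apply Subtype.ext
      rw [AlgHom.coe_codRestrict, hθ]
      exact h
  exact ⟨(Ideal.quotientEquivAlgOfEq k hker.symm).trans (Ideal.quotientKerAlgEquivOfSurjective hsurj)⟩

/-- **Stub (chart image, glue).** For `ev' : k[ℤ^n] → K`, an adapted automorphism `φ` and a vertex `a`
of the lattice-point family `A` with `A − A a ⊆ φ⁻¹(ℕ^n)` containing the dual basis: if the adapted
chart `k[ℕ^n] ⧸ (φ·ker ev' ∩ k[ℕ^n])` is regular at every prime then so is its image
`D_a = k[ev'(x^{A b − A a}) : b] ⊆ K` (first isomorphism theorem), and `D_a` contains `ev'(x^v)` for every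
`v ∈ φ⁻¹(ℕ^n)` (the differences generate the dual cone). [folklore] -/
theorem stub_chartImage :
    ∀ (k : Type) [Field k] (K : Type) [Field K] [Algebra k K] (n N : ℕ) (ev' : AddMonoidAlgebra k (Fin n → ℤ) →ₐ[k] K) (φ : (Fin n → ℤ) ≃+ (Fin n → ℤ)) (A : Fin (N + 1) → (Fin n → ℤ)) (a : Fin (N + 1)), (∀ (b : Fin (N + 1)) (i : Fin n), 0 ≤ φ (A b - A a) i) → (∀ i : Fin n, ∃ b : Fin (N + 1), φ (A b - A a) = Pi.single i 1) → (∀ (P : Ideal (AddMonoidAlgebra k (Fin n → ℕ) ⧸ Literature.AlgebraicGeometry.Tropical.linkIdeal (AddMonoidHom.compLeft (Nat.castAddMonoidHom ℤ) (Fin n)) ((RingHom.ker ev'.toRingHom).map (AddMonoidAlgebra.domCongr k k φ)))) [P.IsPrime], IsRegularLocalRing (Localization.AtPrime P)) → (∀ (P : Ideal ↥(Algebra.adjoin k (Set.range fun b : Fin (N + 1) => ev' (AddMonoidAlgebra.single (A b - A a) (1 : k))))) [P.IsPrime], IsRegularLocalRing (Localization.AtPrime P)) ∧ ∀ v : Fin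 n → ℤ, (∀ i, 0 ≤ φ v i) → ev' (AddMonoidAlgebra.single v (1 : k)) ∈ Algebra.adjoin k (Set.range fun b : Fin (N + 1) => ev' (AddMonoidAlgebra.single (A b - A a) (1 : k))) := by
  intro k _ K _ _ n N ev' φ A a h1 h2 h3
  obtain ⟨e⟩ := schonResolves_nonempty_quotient_linkIdeal_algEquiv_adjoin ev' φ A a h1 h2
  exact ⟨tropicalLinks_forall_prime_regular_of_ringEquiv e.toRingEquiv h3,
    schonResolves_ev_single_mem_adjoin ev' φ A a h2⟩

end Summit.ResolutionOfSingularities.ResolutionOfSingularities.Theorems
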